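import Literature.AnabelianGeometry.AbsoluteAnabelian.RelativeGrothendieckConjecture
import HarnessLib

/-!
# Slimness is invariant under isomorphisms of topological groups; slimness of `G_k`-shaped objects

Proof-only glue for the "Belyi cuspidalization" chain (audit `plan/L4/LC1-CHAIN.md`): the hypothesis
"`G` slim" of [AbsTopII] Cor 3.3 / 3.7 (abc-iut-L4-t6: `IsCor37Input.slim : IsSlimGroup (M.ext X).gal`)
is obtained from "[pGC] Lem 15.8: the absolute Galois group of a sub-`p`-adic field is slim"
(`pGC.Lem_15_8_slim`, about `Field.absoluteGaloisGroup k`) by transport along the model's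
identification `galIso : (ext X).gal ≅ absoluteGaloisGrp k` (abc-iut-L4-t1 `CurveModel`, L4-t6
`BelyiCurveModel`).  PROVED here: `IsSlimGroup` is invariant under `≃ₜ*` and under isomorphisms in
`ProfiniteGrp`, and the resulting corollaries for objects isomorphic to `absoluteGaloisGrp k`, `k`
(generalized) sub-`p`-adic.  No new definitions. [cite: MochizukiAbsTopI2012, Ex 4.8 (ii) p.58]
-/

open CategoryTheory Topology

universe u

namespace Literature.AnabelianGeometry.AbsoluteAnabelian

open Literature.AlgebraicGeometry.Frobenioids AbsTopIII

/-- Slimness ([AbsTopI] §0 p. 8: every open subgroup has trivial centralizer) is transported along an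
isomorphism of topological groups. [cite: MochizukiAbsTopI2012, §0 p.8] -/
theorem isSlimGroup_of_continuousMulEquiv {G H : Type u} [Group G] [TopologicalSpace G] [Group H]
    [TopologicalSpace H] (e : G ≃ₜ* H) (hG : IsSlimGroup G) : IsSlimGroup H := by
  refine ⟨fun U hU => ?_⟩
  rw [eq_bot_iff]
  intro z hz
  -- pull back the open subgroup and the centralizing element along `e`
  have hU' : IsOpen ((U.comap e.toMonoidHom : Subgroup G) : Set G) :=
    hU.preimage e.continuous
  have hz' : e.symm z ∈ Subgroup.centralizer ((U.comap e.toMonoidHom : Subgroup G) : Set G) := by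
    rw [Subgroup.mem_centralizer_iff]
    intro g hg
    apply e.injective
    have := (Subgroup.mem_centralizer_iff.mp hz) (e g) hg
    simpa using this
  have h1 : e.symm z = 1 := by
    have := hG.centralizer_eq_bot _ hU'
    rw [this] at hz'
    exact Subgroup.mem_bot.mp hz'
  rw [Subgroup.mem_bot]
  simpa using congrArg e h1

/-- `IsSlimGroup` is invariant under `≃ₜ*`. [cite: MochizukiAbsTopI2012, §0 p.8] -/
theorem isSlimGroup_congr {G H : Type u} [Group G] [TopologicalSpace G] [Group H]
    [TopologicalSpace H] (e : G ≃ₜ* H) : IsSlimGroup G ↔ IsSlimGroup H :=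
  ⟨isSlimGroup_of_continuousMulEquiv e, isSlimGroup_of_continuousMulEquiv e.symm⟩

/-- An isomorphism in `ProfiniteGrp` as an isomorphism of topological groups.
[cite: MochizukiAbsTopI2012, §0 p.8] -/
theorem nonempty_continuousMulEquiv_of_iso {A B : ProfiniteGrp.{u}} (i : A ≅ B) :
    Nonempty (A ≃ₜ* B) :=
  ⟨{ toFun := i.hom.hom
     invFun := i.inv.hom
     left_inv := fun x => by
       change (i.hom ≫ i.inv).hom x = x
       rw [i.hom_inv_id]
       rfl
     right_inv := fun y => by
       change (i.inv ≫ i.hom).hom y = y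
       rw [i.inv_hom_id]
       rfl
     map_mul' := map_mul i.hom.hom
     continuous_toFun := i.hom.hom.continuous
     continuous_invFun := i.inv.hom.continuous }⟩

/-- Slimness is transported along isomorphisms in `ProfiniteGrp`. [cite: MochizukiAbsTopI2012, §0 p.8] -/
theorem isSlimGroup_of_profiniteGrp_iso {A B : ProfiniteGrp.{u}} (i : A ≅ B) (hA : IsSlimGroup A) :
    IsSlimGroup B := by
  obtain ⟨e⟩ := nonempty_continuousMulEquiv_of_iso i
  exact isSlimGroup_of_continuousMulEquiv e hA

/-- LC1 glue: a profinite group identified with `absoluteGaloisGrp k` (e.g. `(M.ext X).gal` via the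
model's `galIso`) is slim whenever `G_k` is; with `pGC.Lem_15_8_slim` ([pGC] Lem 15.8 as quoted in
[AbsTopI] Ex 4.8 (ii)) this gives the "`G` slim" hypothesis of [AbsTopII] Cor 3.3 / 3.7 for curves
over sub-`p`-adic fields. [cite: MochizukiAbsTopI2012, Ex 4.8 (ii) p.58] -/
theorem isSlimGroup_of_iso_absoluteGaloisGrp_of_isSubpadic (h : pGC.Lem_15_8_slim.{u})
    {k : Type u} [Field k] [CharZero k] (hk : IsSubpadic k) {Γ : ProfiniteGrp.{u}}
    (i : Γ ≅ absoluteGaloisGrp k) : IsSlimGroup Γ :=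
  isSlimGroup_of_profiniteGrp_iso i.symm (h k hk)

/-- The same for generalized sub-`p`-adic base fields, from `Tpcs.Lem_4_14_slim` ([Tpcs] Lem 4.14 as
quoted in [AbsTopI] Ex 4.8 (i)) — the form t6's `IsCor37Input` uses.
[cite: MochizukiAbsTopI2012, Ex 4.8 (i) p.58] -/
theorem isSlimGroup_of_iso_absoluteGaloisGrp_of_isGeneralizedSubpadicFor (h : Tpcs.Lem_4_14_slim.{u})
    {k : Type u} [Field k] [CharZero k] {p : ℕ} [Fact p.Prime] (hk : IsGeneralizedSubpadicFor k p)
    {Γ : ProfiniteGrp.{u}} (i : Γ ≅ absoluteGaloisGrp k) : IsSlimGroup Γ :=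
  isSlimGroup_of_profiniteGrp_iso i.symm (h k p hk)

end Literature.AnabelianGeometry.AbsoluteAnabelian
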